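import Literature.AlgebraicGeometry.Frobenioids.BaseTrivialAutAmple
import Literature.AlgebraicGeometry.Frobenioids.FiberProducts
import HarnessLib

/-!
# Frobenioids I, Proposition 1.6 (v), clause «base-trivial», direction `C ⇒ C′` — proved

Mochizuki, *The geometry of Frobenioids I: the general theory*, Kyushu J. Math. **62** (2008)
293–400, §1, Proposition 1.6 (v), kurims text p. 28 [cite: MochizukiFrdI2008, Prop. 1.6(v) p.28]:
"(v) A object of `C′` is … base-trivial … if and only if it projects to such an object of `C`."

This file proves the direction `C ⇒ C′` of the clause «base-trivial», which abc-iut-found's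
`FiberProductsObjects.lean` left open ("the evident lifting needs an isomorphism of the `C`-component
with prescribed projection to `D`"): the prescribed projection is supplied by
`PreFrobenioid.isAutAmple_of_isBaseTrivial` (`BaseTrivialAutAmple.lean`: in a Frobenioid a
base-trivial object is `Aut`-ample).  Statement: for a Frobenioid `C → F_Φ`, ANY functor
`G : D′ → D` and any object `X = (A, A′, α)` of `C′ = C ×_D D′` whose `C`-component `A` is base-trivial,
`X` is base-trivial in `C′` (no hypothesis on `D′`, `G` is needed for this direction).  Proof-only
companion (abc-iut finding F-t8g2-1 (B)); contrast: the sibling clause «metrically trivial» of (v)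
fails in this direction (`MetricallyTrivialFiberProductCounterexample.lean`).  Nothing here bears on
[IUTchIII].
-/

namespace Literature.AlgebraicGeometry.Frobenioids

open CategoryTheory Opposite

universe w v v' v'' u u' u''

namespace PreFrobenioid

variable {D : Type u} [Category.{v} D] {D' : Type u'} [Category.{v'} D']
  {Φ : Dᵒᵖ ⥤ CommMonCat.{w}} {C : Type u''} [Category.{v''} C]
  {F : C ⥤ ElemFrobenioid Φ} {G : D' ⥤ D}

/-- **Prop. 1.6 (v)**, base-trivial objects, direction `C ⇒ C′`: if `X = (A, A′, α) ∈ C′` projects to a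
base-trivial object `A` of the Frobenioid `C`, then `X` is base-trivial in `C′`.  (Given
`Y = (B, B′, β)` with `B′ ≅ A′`, base-triviality of `A` gives SOME `B ≅ A`; its base is corrected to the
one the compatibility square prescribes by an automorphism of `A` — `A` is `Aut`-ample by
`isAutAmple_of_isBaseTrivial`.) [cite: MochizukiFrdI2008, Prop. 1.6(v) p.28] -/
theorem isBaseTrivial_fiberProduct_of_fst (hF : IsFrobenioid F) (X : FiberProduct F G)
    (hX : IsBaseTrivial F X.fst) : IsBaseTrivial (fiberProductFunctor F G) X := by
  rintro Y ⟨g⟩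
  -- `g : baseObj X ≅ baseObj Y` in `D′`, i.e. `X.snd ≅ Y.snd`
  let g' : X.snd ≅ Y.snd := g
  -- a first isomorphism `f₀ : Y.fst ≅ X.fst` from base-triviality of `X.fst`
  have hbi : BaseIsomorphic F X.fst Y.fst := ⟨X.iso ≪≫ G.mapIso g' ≪≫ Y.iso.symm⟩
  obtain ⟨f₀⟩ := hX Y.fst hbi
  -- the correction: an automorphism of `X.fst` with prescribed base
  let σ : (baseFunctor F).obj X.fst ≅ (baseFunctor F).obj X.fst :=
    ((baseFunctor F).mapIso f₀).symm ≪≫ Y.iso ≪≫ (G.mapIso g').symm ≪≫ X.iso.symm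
  obtain ⟨τ, hτ⟩ := isAutAmple_of_isBaseTrivial hF hX σ
  have hτ' : Base F τ.hom = σ.hom := congrArg Iso.hom hτ
  refine ⟨CFP.isoMk (f₀ ≪≫ τ) g'.symm ?_⟩
  -- the compatibility square `Base(f₀ ≫ τ) ≫ α = β ≫ G(g⁻¹)`
  show Base F (f₀.hom ≫ τ.hom) ≫ X.iso.hom = Y.iso.hom ≫ G.map g'.inv
  rw [base_comp, hτ']
  show ((baseFunctor F).map f₀.hom ≫
      ((baseFunctor F).map f₀.inv ≫ Y.iso.hom ≫ G.map g'.inv ≫ X.iso.inv)) ≫ X.iso.hom = _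
  simp only [Category.assoc, Iso.inv_hom_id, Category.comp_id]
  rw [← Functor.map_comp_assoc, Iso.hom_inv_id, CategoryTheory.Functor.map_id, Category.id_comp]

/-- **Prop. 1.6 (v)**, «base-trivial»: if `C` is of base-trivial type then so is `C′ = C ×_D D′`.
[cite: MochizukiFrdI2008, Prop. 1.6(v) p.28] -/
theorem isOfType_isBaseTrivial_fiberProduct (hF : IsFrobenioid F)
    (h : IsOfType (IsBaseTrivial F)) : IsOfType (IsBaseTrivial (fiberProductFunctor F G)) :=
  fun X => isBaseTrivial_fiberProduct_of_fst hF X (h X.fst)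

end PreFrobenioid

end Literature.AlgebraicGeometry.Frobenioids
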